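import Literature.NumberTheory.GelbartRogawski1991.PiSCompletionIsThetaTypeTestSigned   -- ★ p848317 (D-b)ᵀˢ `piSCompletion_isThetaTypeAtCMTestSigned` (binder block + body copied BYTE-IDENTICALLY below, two hypotheses inserted)
import HarnessLib

/-!
# (D-b)ᵀˢ ON THE WEIGHT-ONE ∕ AUTOMORPHIC LOCUS: `piSCompletion_isThetaTypeAtCMTestSignedW1` (statement only)

Gelbart–Rogawski, Invent. Math. 105 (1991), §3.4 Prop. 3.4.1, Thm. 3.4 (a) (pp. 459–461), Lem. 5.1.2 with Thm. 5.1.1 (pp. 465–466); Rogawski, Ann. of Math. Stud. 123 (1990),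
Prop. 13.1.3 (d), Prop. 13.1.4 p. 199, §4.9 p. 55, Thm. 13.3.6 (c); Liu, Invent. Math. 225 (2021), Def. 4.11, Prop. 4.13.  Cell `hodgecm-mathlib` (D-0151), crux H413 =
stmt-HodgeConjecture-24833, FLOOR 0 line LH10 «(D-b)ᵀ», ROAD W; typed by LH10-plan (g0) on LH10-p02 (g0)'s «AUTOMORPHY GAP» finding (2026-09-02T02:52:49Z ∕ 03:19:42Z) and
F0P2-p06 (g14)'s P2-cone census (03:24:26Z); F0P2-ref1 (g10) r363∕r364 «CONDITIONAL GO on the P2 side», item (b) (token rules (i)–(iv)).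

WHAT.  ★ `piSCompletion_isThetaTypeAtCMTestSigned` (p848317, unchanged — kept) quantifies over EVERY pair `(μ, χ_f)` on letter #76's two dictionary equations (DICT1: `μ̃` agrees
semilocally with `ξ.bcη⁻¹·ξ.bcψ⁻¹·μω`; DICT2: `χ_f ∘ check` is the finite part of `ξ.bcψ⁻¹·(ξ.bcη⁻¹·ξ.bcψ⁻¹·μω)²`).  This edition is the SAME TEXT with exactly TWO hypotheses
inserted after `Continuous χf → (∀ z, ‖χf z‖ = 1) →` at both sites (the `def` body and its `Iff.rfl` unfolding):
`HasWeight L μ 1 →` (★ `ConjugateSelfDualCharacters.HasWeight`: `μ` has weight one at every infinite place) and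
`IsAutomorphicOneChar (↥(maximalRealSubfield L)) L (IsCMField.complexConj L) χf →` (★ [Liu2021 Def. 4.11]: `χ_f` is continuous and trivial on the rational norm-one units, i.e.
`⟨χf, ‹this›⟩ : Chi …` is an automorphic character of `U(1)`).  Nothing else differs; the restricted predicate is WEAKER (`…TestSigned_toW1` below, one line).

WHY.  (i) PRINT-TRUTH is unchanged: it is (D-b)ᵀˢ [GelbartRogawski1991 Lem. 5.1.2 + Thm. 5.1.1 at the SIGNED (13.1.4), RULING «K»] read on a sub-locus of its `∀`.
(ii) PAYABILITY: DICT2 pins only the finite idelic check of `χ_f`; an automorphic `χ : Chi` with `χ.1 = χ_f` exists iff the archimedean types of `(μω, ξ.η, ξ.ψ)` satisfy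
`m_w(μω) = 2e_w(η̃) + 3e_w(ψ̃)` at every complex `w` (LH10-p02: at `ξ := OneDimAutRepH.trivial` NO automorphic `χ` exists, for every `(L, H, μω)`), and the tree's theta engine
(★ `F0P2tThetaOccursInGenNeg.thetaOccursInGen`, S2♯-θ ★ `F0P2uS2SharpTheta.memXiFamily_of_theta_of_clauses`, ★ `F0P3cDbTThetaLiftMemberOfTheta`) produces the global theta
member `ω(γ, ψ^ε, χ)` [GR91 §3.4] exactly for automorphic `χ` and weight-one `μ` — Liu's corner [Liu2021 Prop. 4.13: `χ_∞ = 1`, weight one].  On this locus (D-b)ᵀˢ is payable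
IN-HOUSE from the theta engine plus the Π(ξ)-rigidity core [Rogawski1990 Thm. 13.3.6 (c)]; off it only by print's global argument.  (iii) COST TO CONSUMERS = 2 arguments: the
`∀ μ χ_f` of DOCKᵀ ∕ (D-b)ᵀˢ is eliminated at ONE site in the P2 cone (★ `F0P2oD7alphaMembersThetaClassTest.d7alpha_packet_members_thetaClassTest` :143), at the DICT-choice
witness `(F0P2iGRDWitness.grdMu, F0P2iGRDWitness.grdChi)` of `ξ`, where `hw : HasWeight L grdMu 1` and `haut : IsAutomorphicOneChar … grdChi` are in scope (★
`F0P2iRIGinfDischarge.rigInf_node_of_xiArchPinned`, exported by ★ `F0P2vPKPiOfTokens.pkPi_of_tokens` :176–:180) — F0P2-p06 census.  HONEST CAVEAT: the summit instantiates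
only Liu's triple, so nothing HC_CM uses is lost, but a books row paid through THIS letter is «(D-b)ᵀˢ-W1», not (D-b).
PRINT-TRUE ONLY AT THE TRANSFER DATA OF RECORD, exactly as ★ p848317: assert it only inside a joint hypothesis with `CMCharIdentityPackageTestSigned … Δ mH mG`, test-function
transfer existence (H₇), Haar `ν_G` (and, since F0P2-ref1 r359 ⑨, print's pins `Δ = finExplicitCollection …`, canonical orbital measures) — never free-standing (r235 ∕ r353 (E)).
STATEMENT ONLY: one `def … : Prop` + its `Iff.rfl` unfolding + the one-line weakening from ★ p848317; no instance, no notation, no `sorry`; nothing is asserted.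
Consumers: the W1 twins of P2's SIGNED rows adapter ∕ node (F0P2-p06 (c)(d)(e)); the LH10 ROAD-W head `Db_T_of_organsW1` (`Cruxes/H413/Lines/F0_P3c_DbTPaydown.lean`, ED. 5-W).

* `piSCompletion_isThetaTypeAtCMTestSignedW1` — the named fact (D-b)ᵀˢ-W1; `…W1_iff` — its unfolding (`Iff.rfl`); `…TestSigned_toW1` — ★ (D-b)ᵀˢ ⟹ (D-b)ᵀˢ-W1.

## References
* [GelbartRogawski1991] S. Gelbart, J. Rogawski, Invent. Math. 105 (1991): §3.4 Prop. 3.4.1 pp. 459–460, Thm. 3.4 (a) p. 461; §5.1 (5.1.1), Thm. 5.1.1 p. 465, Lem. 5.1.2 p. 466.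
* [Rogawski1990] J. Rogawski, Ann. of Math. Stud. 123 (1990): §13.1 Prop. 13.1.3 (d), Prop. 13.1.4 p. 199; §4.9 p. 55; §13.3 Thm. 13.3.6 (c) pp. 201–203.
* [Liu2021] Y. Liu, Invent. Math. 225 (2021): Def. 4.11 (l. 2090), Prop. 4.13.
* [LanglandsShelstad1987] R. Langlands, D. Shelstad, Math. Ann. 278 (1987): §1 (normalisation of transfer factors).
-/

noncomputable section

open NumberField IsDedekindDomain MeasureTheory
open scoped Matrix ComplexOrder

namespace Literature.NumberTheory.GelbartRogawski1991

open Literature.NumberTheory Literature.NumberTheory.Automorphic Literature.NumberTheory.Automorphic.UnitaryGroup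
open Literature.NumberTheory.Automorphic.IdeleClassGroup
open Literature.NumberTheory.Automorphic.Liu2021 Literature.NumberTheory.Automorphic.Liu2021.Def411WeilCarriers
open Literature.NumberTheory.GaloisRepresentations
open Literature.NumberTheory.Rogawski1990

variable (L : Type) [Field L] [NumberField L] [IsCMField L] (H : Matrix (Fin 3) (Fin 3) L)

open scoped Classical in
/-- **(D-b)ᵀˢ-W1 — THE SIGNED TEST-FUNCTION EDITION ON THE WEIGHT-ONE ∕ AUTOMORPHIC LOCUS** [GelbartRogawski1991 Lem. 5.1.2 + Thm. 5.1.1, §3.4 Thm. 3.4 (a); Rogawski1990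
Prop. 13.1.3 (d), Prop. 13.1.4, §4.9; Liu2021 Def. 4.11]: ★ `piSCompletion_isThetaTypeAtCMTestSigned` (binders byte-identical, same order) with the pair `(μ, χ_f)` restricted by
`HasWeight L μ 1` and `IsAutomorphicOneChar … χf` (inserted after the unit-norm hypothesis): for every such DICT-tied pair, every non-split finite `v`, every form congruence
`ᵗT̄·H_v·T = a·Φ₃`, every Haar `μZ` and every Keys-labelled `(π², πⁿ)` with `πⁿ` not square-integrable, SOME line class `ε` and SOME class `πθ` of `U(H)(L⁺_v)` complete
`πⁿ ∘ e` in (13.1.4) ON TEST FUNCTIONS with member traces `× ε_v(a)`, and `πθ` is the theta type `X_v(μ, ε, χ_f) ∘ κ_v⁻¹`.  = print's (D-b)ᵀˢ [cites as the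
ENCLOSING printed statements] RESTRICTED to the weight-one automorphic locus `(HasWeight μ 1, IsAutomorphicOneChar χf)` — the only locus HC_CM instantiates (★ `pkPi_of_tokens`
:208–:221 ∕ skeleton `F0_P2PKPiRung4.lean` :936); in-house road LH10-p02 ‹O1♭″› (★ `F0P3cDbTThetaOccurrenceLiuLocus`) + [Rogawski1990 Thm. 13.3.6 (c)]; WEAKER than ★ p848317
(`piSCompletion_isThetaTypeAtCMTestSigned_toW1`).  To be asserted only inside a joint hypothesis with
`CMCharIdentityPackageTestSigned … Δ mH mG`, (H₇), Haar `ν_G` and print's data pins — never free-standing (F0P2-ref1 r235 ∕ r353 (E) ∕ r359 ⑨).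
[cite: GelbartRogawski1991, Lem. 5.1.2 p. 466; Thm. 5.1.1 p. 465; Thm. 3.4 (a) p. 461] [cite: Rogawski1990, §13.1 Prop. 13.1.3 (d), Prop. 13.1.4 p. 199; §4.9 p. 55; §13.3 Thm. 13.3.6 (c) p. 202] [cite: Liu2021, Def. 4.11 (l. 2090)] [cite: LanglandsShelstad1987, §1] -/
def piSCompletion_isThetaTypeAtCMTestSignedW1
    [∀ v : HeightOneSpectrum (𝓞 ↥(maximalRealSubfield L)), MeasurableSpace ((cmDatum L 3 H).Local v)]
    [∀ v : HeightOneSpectrum (𝓞 ↥(maximalRealSubfield L)),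
      MeasurableSpace ((cmDatum L 2 (Matrix.of fun i j : Fin 2 => if i.val + j.val + 1 = 2 then (1 : L) else 0)).Local v ×
        (cmDatum L 1 (Matrix.of fun i j : Fin 1 => if i.val + j.val + 1 = 1 then (1 : L) else 0)).Local v)]
    [∀ (v : HeightOneSpectrum (𝓞 ↥(maximalRealSubfield L)))
        (a : ((cmDatum L 2 (Matrix.of fun i j : Fin 2 => if i.val + j.val + 1 = 2 then (1 : L) else 0)).Local v ×
          (cmDatum L 1 (Matrix.of fun i j : Fin 1 => if i.val + j.val + 1 = 1 then (1 : L) else 0)).Local v)),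
      MeasurableSpace (((cmDatum L 2 (Matrix.of fun i j : Fin 2 => if i.val + j.val + 1 = 2 then (1 : L) else 0)).Local v ×
          (cmDatum L 1 (Matrix.of fun i j : Fin 1 => if i.val + j.val + 1 = 1 then (1 : L) else 0)).Local v) ⧸
        Subgroup.centralizer ({a} : Set ((cmDatum L 2 (Matrix.of fun i j : Fin 2 => if i.val + j.val + 1 = 2 then (1 : L) else 0)).Local v ×
          (cmDatum L 1 (Matrix.of fun i j : Fin 1 => if i.val + j.val + 1 = 1 then (1 : L) else 0)).Local v)))]
    [∀ (v : HeightOneSpectrum (𝓞 ↥(maximalRealSubfield L))) (γ : (cmDatum L 3 H).Local v),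
      MeasurableSpace ((cmDatum L 3 H).Local v ⧸ Subgroup.centralizer ({γ} : Set ((cmDatum L 3 H).Local v)))]
    (Δ : ∀ v : HeightOneSpectrum (𝓞 ↥(maximalRealSubfield L)), LocalTransferFactor L H v)
    (mH : ∀ v : HeightOneSpectrum (𝓞 ↥(maximalRealSubfield L)),
      OrbitalMeasureFamily ((cmDatum L 2 (Matrix.of fun i j : Fin 2 => if i.val + j.val + 1 = 2 then (1 : L) else 0)).Local v ×
        (cmDatum L 1 (Matrix.of fun i j : Fin 1 => if i.val + j.val + 1 = 1 then (1 : L) else 0)).Local v))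
    (mG : ∀ v : HeightOneSpectrum (𝓞 ↥(maximalRealSubfield L)), OrbitalMeasureFamily ((cmDatum L 3 H).Local v))
    (νH : ∀ v : HeightOneSpectrum (𝓞 ↥(maximalRealSubfield L)),
      Measure ((cmDatum L 2 (Matrix.of fun i j : Fin 2 => if i.val + j.val + 1 = 2 then (1 : L) else 0)).Local v ×
        (cmDatum L 1 (Matrix.of fun i j : Fin 1 => if i.val + j.val + 1 = 1 then (1 : L) else 0)).Local v))
    (νG : ∀ v : HeightOneSpectrum (𝓞 ↥(maximalRealSubfield L)), Measure ((cmDatum L 3 H).Local v))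
    (ξ : OneDimAutRepH L) (μω : HeckeCharacter L)
    (ξloc : ∀ v : HeightOneSpectrum (𝓞 ↥(maximalRealSubfield L)),
      (cmDatum L 2 (Matrix.of fun i j : Fin 2 => if i.val + j.val + 1 = 2 then (1 : L) else 0)).Local v ×
        (cmDatum L 1 (Matrix.of fun i j : Fin 1 => if i.val + j.val + 1 = 1 then (1 : L) else 0)).Local v →* ℂˣ)
    {n' : ℕ} (e₁ : Fin 3 × Fin 1 ≃ Fin n') (dV : Fin 3 → L) (hdV : ∀ i, IsCMField.complexConj L (dV i) = dV i) (hdV0 : ∀ i, dV i ≠ 0) (g : GL (Fin 3) L)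
    (hg : ((g : Matrix (Fin 3) (Fin 3) L).map (cmConjRingHom L))ᵀ * H * (g : Matrix (Fin 3) (Fin 3) L) = Matrix.diagonal dV) : Prop :=
    ∀ (μ : Literature.NumberTheory.Automorphic.IdeleClassGroup L →ₜ* Circle) (hμ : IsConjugateSymplectic L μ)
    (χf : UnitaryGroup.finAdelicOne (↥(maximalRealSubfield L)) L (IsCMField.complexConj L) →* ℂˣ),
    Continuous χf → (∀ z, ‖((χf z : ℂˣ) : ℂ)‖ = 1) →
    HasWeight L μ 1 → IsAutomorphicOneChar (↥(maximalRealSubfield L)) L (IsCMField.complexConj L) χf →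
    (∀ v : HeightOneSpectrum (𝓞 ↥(maximalRealSubfield L)),
        (toHeckeCharacter L μ).semilocalComponent L v = (ξ.bcη⁻¹ * ξ.bcψ⁻¹ * μω).semilocalComponent L v) →
    (∀ z : (FiniteAdeleRing (𝓞 L) L)ˣ,
        χf (finAdelicCheck (↥(maximalRealSubfield L)) L (IsCMField.complexConj L)
            (AlgEquiv.ext fun x => by rw [AlgEquiv.mul_apply, IsCMField.complexConj_apply_apply, AlgEquiv.one_apply]) z) =
          (ξ.bcψ⁻¹ * (ξ.bcη⁻¹ * ξ.bcψ⁻¹ * μω) ^ 2)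
            (Units.map (N := AdeleRing (𝓞 L) L) (MonoidHom.inr (InfiniteAdeleRing L) (FiniteAdeleRing (𝓞 L) L)) z)) →
    ∀ (v : HeightOneSpectrum (𝓞 ↥(maximalRealSubfield L))),
      (∀ w : PlacesOver L v, IsCMField.complexConj L • w.1 = w.1) →
      ∀ (T : GL (Fin 3) (LocalRing L v)) (a : LocalRing L v) (ha : IsUnit a)
        (h : formCongr (conjLocal L (IsCMField.complexConj L) v) T (H.map (algebraMap L (LocalRing L v))) =
          a • (Matrix.of fun i j : Fin 3 => if i.val + j.val + 1 = 3 then (1 : L) else 0).map (algebraMap L (LocalRing L v))),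
      ∀ [MeasurableSpace (Gqs L v ⧸ Subgroup.center (Gqs L v))] [BorelSpace (Gqs L v ⧸ Subgroup.center (Gqs L v))]
        (μZ : Measure (Gqs L v ⧸ Subgroup.center (Gqs L v))) [μZ.IsHaarMeasure],
      ∀ (π2 πn : IrrClass (Gqs L v)),
        KeysCaseTwoLabels L v (μω.semilocalComponent L v) (torusLocalComponent L (IsCMField.complexConj L) v ξ.η)
          (torusLocalComponent L (IsCMField.complexConj L) v ξ.ψ) π2 πn →
        ¬ πn.IsSquareIntegrable μZ →
        ∃ (ε : (↥(maximalRealSubfield L))ˣ) (πθ : IrrClass ((cmDatum L 3 H).Local v)),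
          (⟨IrrClass.comap (cmDatumLocalCongr L v T ha h).symm πn, some πθ⟩ : CMLocalAPacket L H v).CharIdentityAtTest L H v
              (fun c f => (if ∃ z : LocalRing L v, IsUnit z ∧ a = z * conjLocal L (IsCMField.complexConj L) v z then (1 : ℂ) else -1) * c.smoothTrace (νG v) f) (ξloc v) (νH v) (Δ v) (mH v) (mG v) ∧
            ThetaTypeAtCM L H e₁ dV hdV hdV0 g hg μ hμ χf ε v πθ


open scoped Classical in
/-- Unfolding of `piSCompletion_isThetaTypeAtCMTestSignedW1` (definitional). [cite: GelbartRogawski1991, Lem. 5.1.2 p. 466] [cite: Rogawski1990, §13.1 Prop. 13.1.4 p. 199; §4.9 p. 55] -/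
theorem piSCompletion_isThetaTypeAtCMTestSignedW1_iff
    [∀ v : HeightOneSpectrum (𝓞 ↥(maximalRealSubfield L)), MeasurableSpace ((cmDatum L 3 H).Local v)]
    [∀ v : HeightOneSpectrum (𝓞 ↥(maximalRealSubfield L)),
      MeasurableSpace ((cmDatum L 2 (Matrix.of fun i j : Fin 2 => if i.val + j.val + 1 = 2 then (1 : L) else 0)).Local v ×
        (cmDatum L 1 (Matrix.of fun i j : Fin 1 => if i.val + j.val + 1 = 1 then (1 : L) else 0)).Local v)]
    [∀ (v : HeightOneSpectrum (𝓞 ↥(maximalRealSubfield L)))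
        (a : ((cmDatum L 2 (Matrix.of fun i j : Fin 2 => if i.val + j.val + 1 = 2 then (1 : L) else 0)).Local v ×
          (cmDatum L 1 (Matrix.of fun i j : Fin 1 => if i.val + j.val + 1 = 1 then (1 : L) else 0)).Local v)),
      MeasurableSpace (((cmDatum L 2 (Matrix.of fun i j : Fin 2 => if i.val + j.val + 1 = 2 then (1 : L) else 0)).Local v ×
          (cmDatum L 1 (Matrix.of fun i j : Fin 1 => if i.val + j.val + 1 = 1 then (1 : L) else 0)).Local v) ⧸
        Subgroup.centralizer ({a} : Set ((cmDatum L 2 (Matrix.of fun i j : Fin 2 => if i.val + j.val + 1 = 2 then (1 : L) else 0)).Local v ×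
          (cmDatum L 1 (Matrix.of fun i j : Fin 1 => if i.val + j.val + 1 = 1 then (1 : L) else 0)).Local v)))]
    [∀ (v : HeightOneSpectrum (𝓞 ↥(maximalRealSubfield L))) (γ : (cmDatum L 3 H).Local v),
      MeasurableSpace ((cmDatum L 3 H).Local v ⧸ Subgroup.centralizer ({γ} : Set ((cmDatum L 3 H).Local v)))]
    (Δ : ∀ v : HeightOneSpectrum (𝓞 ↥(maximalRealSubfield L)), LocalTransferFactor L H v)
    (mH : ∀ v : HeightOneSpectrum (𝓞 ↥(maximalRealSubfield L)),
      OrbitalMeasureFamily ((cmDatum L 2 (Matrix.of fun i j : Fin 2 => if i.val + j.val + 1 = 2 then (1 : L) else 0)).Local v ×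
        (cmDatum L 1 (Matrix.of fun i j : Fin 1 => if i.val + j.val + 1 = 1 then (1 : L) else 0)).Local v))
    (mG : ∀ v : HeightOneSpectrum (𝓞 ↥(maximalRealSubfield L)), OrbitalMeasureFamily ((cmDatum L 3 H).Local v))
    (νH : ∀ v : HeightOneSpectrum (𝓞 ↥(maximalRealSubfield L)),
      Measure ((cmDatum L 2 (Matrix.of fun i j : Fin 2 => if i.val + j.val + 1 = 2 then (1 : L) else 0)).Local v ×
        (cmDatum L 1 (Matrix.of fun i j : Fin 1 => if i.val + j.val + 1 = 1 then (1 : L) else 0)).Local v))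
    (νG : ∀ v : HeightOneSpectrum (𝓞 ↥(maximalRealSubfield L)), Measure ((cmDatum L 3 H).Local v))
    (ξ : OneDimAutRepH L) (μω : HeckeCharacter L)
    (ξloc : ∀ v : HeightOneSpectrum (𝓞 ↥(maximalRealSubfield L)),
      (cmDatum L 2 (Matrix.of fun i j : Fin 2 => if i.val + j.val + 1 = 2 then (1 : L) else 0)).Local v ×
        (cmDatum L 1 (Matrix.of fun i j : Fin 1 => if i.val + j.val + 1 = 1 then (1 : L) else 0)).Local v →* ℂˣ)
    {n' : ℕ} (e₁ : Fin 3 × Fin 1 ≃ Fin n') (dV : Fin 3 → L) (hdV : ∀ i, IsCMField.complexConj L (dV i) = dV i) (hdV0 : ∀ i, dV i ≠ 0) (g : GL (Fin 3) L)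
    (hg : ((g : Matrix (Fin 3) (Fin 3) L).map (cmConjRingHom L))ᵀ * H * (g : Matrix (Fin 3) (Fin 3) L) = Matrix.diagonal dV) :
    piSCompletion_isThetaTypeAtCMTestSignedW1 L H Δ mH mG νH νG ξ μω ξloc e₁ dV hdV hdV0 g hg ↔
    (  ∀ (μ : Literature.NumberTheory.Automorphic.IdeleClassGroup L →ₜ* Circle) (hμ : IsConjugateSymplectic L μ)
        (χf : UnitaryGroup.finAdelicOne (↥(maximalRealSubfield L)) L (IsCMField.complexConj L) →* ℂˣ),
        Continuous χf → (∀ z, ‖((χf z : ℂˣ) : ℂ)‖ = 1) →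
        HasWeight L μ 1 → IsAutomorphicOneChar (↥(maximalRealSubfield L)) L (IsCMField.complexConj L) χf →
        (∀ v : HeightOneSpectrum (𝓞 ↥(maximalRealSubfield L)),
            (toHeckeCharacter L μ).semilocalComponent L v = (ξ.bcη⁻¹ * ξ.bcψ⁻¹ * μω).semilocalComponent L v) →
        (∀ z : (FiniteAdeleRing (𝓞 L) L)ˣ,
            χf (finAdelicCheck (↥(maximalRealSubfield L)) L (IsCMField.complexConj L)
                (AlgEquiv.ext fun x => by rw [AlgEquiv.mul_apply, IsCMField.complexConj_apply_apply, AlgEquiv.one_apply]) z) =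
              (ξ.bcψ⁻¹ * (ξ.bcη⁻¹ * ξ.bcψ⁻¹ * μω) ^ 2)
                (Units.map (N := AdeleRing (𝓞 L) L) (MonoidHom.inr (InfiniteAdeleRing L) (FiniteAdeleRing (𝓞 L) L)) z)) →
        ∀ (v : HeightOneSpectrum (𝓞 ↥(maximalRealSubfield L))),
          (∀ w : PlacesOver L v, IsCMField.complexConj L • w.1 = w.1) →
          ∀ (T : GL (Fin 3) (LocalRing L v)) (a : LocalRing L v) (ha : IsUnit a)
            (h : formCongr (conjLocal L (IsCMField.complexConj L) v) T (H.map (algebraMap L (LocalRing L v))) =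
              a • (Matrix.of fun i j : Fin 3 => if i.val + j.val + 1 = 3 then (1 : L) else 0).map (algebraMap L (LocalRing L v))),
          ∀ [MeasurableSpace (Gqs L v ⧸ Subgroup.center (Gqs L v))] [BorelSpace (Gqs L v ⧸ Subgroup.center (Gqs L v))]
            (μZ : Measure (Gqs L v ⧸ Subgroup.center (Gqs L v))) [μZ.IsHaarMeasure],
          ∀ (π2 πn : IrrClass (Gqs L v)),
            KeysCaseTwoLabels L v (μω.semilocalComponent L v) (torusLocalComponent L (IsCMField.complexConj L) v ξ.η)
              (torusLocalComponent L (IsCMField.complexConj L) v ξ.ψ) π2 πn →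
            ¬ πn.IsSquareIntegrable μZ →
            ∃ (ε : (↥(maximalRealSubfield L))ˣ) (πθ : IrrClass ((cmDatum L 3 H).Local v)),
              (⟨IrrClass.comap (cmDatumLocalCongr L v T ha h).symm πn, some πθ⟩ : CMLocalAPacket L H v).CharIdentityAtTest L H v
                  (fun c f => (if ∃ z : LocalRing L v, IsUnit z ∧ a = z * conjLocal L (IsCMField.complexConj L) v z then (1 : ℂ) else -1) * c.smoothTrace (νG v) f) (ξloc v) (νH v) (Δ v) (mH v) (mG v) ∧
                ThetaTypeAtCM L H e₁ dV hdV hdV0 g hg μ hμ χf ε v πθ) :=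
  Iff.rfl

/-- ★ (D-b)ᵀˢ (`piSCompletion_isThetaTypeAtCMTestSigned`, p848317) implies its restriction (D-b)ᵀˢ-W1 — the two inserted hypotheses are simply not used.
[cite: GelbartRogawski1991, Lem. 5.1.2 p. 466] [cite: Liu2021, Def. 4.11 (l. 2090)] -/
theorem piSCompletion_isThetaTypeAtCMTestSigned_toW1
    [∀ v : HeightOneSpectrum (𝓞 ↥(maximalRealSubfield L)), MeasurableSpace ((cmDatum L 3 H).Local v)]
    [∀ v : HeightOneSpectrum (𝓞 ↥(maximalRealSubfield L)),
      MeasurableSpace ((cmDatum L 2 (Matrix.of fun i j : Fin 2 => if i.val + j.val + 1 = 2 then (1 : L) else 0)).Local v ×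
        (cmDatum L 1 (Matrix.of fun i j : Fin 1 => if i.val + j.val + 1 = 1 then (1 : L) else 0)).Local v)]
    [∀ (v : HeightOneSpectrum (𝓞 ↥(maximalRealSubfield L)))
        (a : ((cmDatum L 2 (Matrix.of fun i j : Fin 2 => if i.val + j.val + 1 = 2 then (1 : L) else 0)).Local v ×
          (cmDatum L 1 (Matrix.of fun i j : Fin 1 => if i.val + j.val + 1 = 1 then (1 : L) else 0)).Local v)),
      MeasurableSpace (((cmDatum L 2 (Matrix.of fun i j : Fin 2 => if i.val + j.val + 1 = 2 then (1 : L) else 0)).Local v ×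
          (cmDatum L 1 (Matrix.of fun i j : Fin 1 => if i.val + j.val + 1 = 1 then (1 : L) else 0)).Local v) ⧸
        Subgroup.centralizer ({a} : Set ((cmDatum L 2 (Matrix.of fun i j : Fin 2 => if i.val + j.val + 1 = 2 then (1 : L) else 0)).Local v ×
          (cmDatum L 1 (Matrix.of fun i j : Fin 1 => if i.val + j.val + 1 = 1 then (1 : L) else 0)).Local v)))]
    [∀ (v : HeightOneSpectrum (𝓞 ↥(maximalRealSubfield L))) (γ : (cmDatum L 3 H).Local v),
      MeasurableSpace ((cmDatum L 3 H).Local v ⧸ Subgroup.centralizer ({γ} : Set ((cmDatum L 3 H).Local v)))]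
    (Δ : ∀ v : HeightOneSpectrum (𝓞 ↥(maximalRealSubfield L)), LocalTransferFactor L H v)
    (mH : ∀ v : HeightOneSpectrum (𝓞 ↥(maximalRealSubfield L)),
      OrbitalMeasureFamily ((cmDatum L 2 (Matrix.of fun i j : Fin 2 => if i.val + j.val + 1 = 2 then (1 : L) else 0)).Local v ×
        (cmDatum L 1 (Matrix.of fun i j : Fin 1 => if i.val + j.val + 1 = 1 then (1 : L) else 0)).Local v))
    (mG : ∀ v : HeightOneSpectrum (𝓞 ↥(maximalRealSubfield L)), OrbitalMeasureFamily ((cmDatum L 3 H).Local v))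
    (νH : ∀ v : HeightOneSpectrum (𝓞 ↥(maximalRealSubfield L)),
      Measure ((cmDatum L 2 (Matrix.of fun i j : Fin 2 => if i.val + j.val + 1 = 2 then (1 : L) else 0)).Local v ×
        (cmDatum L 1 (Matrix.of fun i j : Fin 1 => if i.val + j.val + 1 = 1 then (1 : L) else 0)).Local v))
    (νG : ∀ v : HeightOneSpectrum (𝓞 ↥(maximalRealSubfield L)), Measure ((cmDatum L 3 H).Local v))
    (ξ : OneDimAutRepH L) (μω : HeckeCharacter L)
    (ξloc : ∀ v : HeightOneSpectrum (𝓞 ↥(maximalRealSubfield L)),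
      (cmDatum L 2 (Matrix.of fun i j : Fin 2 => if i.val + j.val + 1 = 2 then (1 : L) else 0)).Local v ×
        (cmDatum L 1 (Matrix.of fun i j : Fin 1 => if i.val + j.val + 1 = 1 then (1 : L) else 0)).Local v →* ℂˣ)
    {n' : ℕ} (e₁ : Fin 3 × Fin 1 ≃ Fin n') (dV : Fin 3 → L) (hdV : ∀ i, IsCMField.complexConj L (dV i) = dV i) (hdV0 : ∀ i, dV i ≠ 0) (g : GL (Fin 3) L)
    (hg : ((g : Matrix (Fin 3) (Fin 3) L).map (cmConjRingHom L))ᵀ * H * (g : Matrix (Fin 3) (Fin 3) L) = Matrix.diagonal dV)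
    (hDb : piSCompletion_isThetaTypeAtCMTestSigned L H Δ mH mG νH νG ξ μω ξloc e₁ dV hdV hdV0 g hg) :
    piSCompletion_isThetaTypeAtCMTestSignedW1 L H Δ mH mG νH νG ξ μω ξloc e₁ dV hdV hdV0 g hg :=
  fun μ hμ χf hc hn _ _ => hDb μ hμ χf hc hn

end Literature.NumberTheory.GelbartRogawski1991

end
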